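import Summits.HodgeConjecture.HodgeConjecture.Theses.MirrorBraneLift

/-!
# Refutation of `MirrorBraneLift.LagrangianLift` (route item stmt-HodgeConjecture-18677)

The crux `LagrangianLift` (Hicks's geometric A-realizability, adapted) asks, for EVERY term
`V : TropicalTorusCycle (2n) n P.Q` and every `ε > 0`, for a compact manifold `L` and a map
`f : L → 𝕏(B_Q)` with `IsGeometricLift P.Q V ε f`, whose field `conormal : IsConormalOver P.Q V ε f`
says: over the `ε`-core of EACH cell `σ` the part of `f(L)` is exactly `w_σ` sheets
`core_ε(σ) × (a_j + L_σ^⊥)` in that cell's OWN conormal direction `L_σ^⊥`.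

`TropicalTorusCycle` is a presentation format (cells + closedness certificate, designed for
class-level consumers `cyc` / `functional`, see its docstring): nothing makes the presentation
face-to-face, so two top cells may have relative interiors meeting in the torus. When they do, at a
common core point `b₀` the fibre of `f(L)` over `b₀` must be a finite union of translates of
`L_σ^⊥ / ℤ` and of `L_σ'^⊥ / ℤ` simultaneously — impossible when `L_σ ≠ L_σ'`.

## Witness (all explicit; `n = 2`, `δ = 1`, `Q = 1`, `ε = 1/10`)

* `P = ⟨1, _, _⟩ : WeilFamily.Polarization 2 1` — the square Gaussian torus `B = ℝ⁴/ℤ⁴`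
  (`J 2 1` is antisymmetric, `1` is positive definite).
* `V` = the sum of the two transversal flat 2-subtori `T₁ = ⟨e₀,e₁⟩/ℤ²` and
  `T₂ = q + ⟨e₂,e₃⟩/ℤ²`, `q = (3/5, 3/10, -3/5, -3/10)`, each triangulated by the two triangles of a
  fundamental square (4 cells of weight 1, frames `(e₀|e₁)`, `(e₂|e₃)`, 6 facet classes; the
  closedness certificate is checked by `simp`). `T₁ ∩ T₂ = {b₀}`, `b₀ = (3/5, 3/10, 0, 0)`, and `b₀`
  lies in the `1/10`-core of the lower triangle of EACH torus (barycentric coordinates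
  `(2/5, 3/10, 3/10)`, sup-metric).
* For any `f` conormal over both cores and any `c ∈ L_{T₁}^⊥ = ⟨e₂,e₃⟩`, the point
  `pt b₀ (a + c)` lies in `f(L)` over `core(cell0)`, hence over `core(cell2)`, hence equals
  `pt b' (a' + c')` with `c' ∈ ⟨e₀,e₁⟩`; comparing the `e₂`-coordinates modulo `ℤ` for `c = 0` and
  `c = e₂/2` gives `1/2 ∈ ℤ`.

So NO `L`, `f` exist (not even the empty manifold), and `LagrangianLift` is false as typed.

## Classification: refuted-misstated

The author plainly intended face-to-face presentations ("clean self-intersections … are expected at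
vertices where several top cells meet transversally", docstring of `TropicalLagrangianLift`).
Repaired statement C′ (minimal; as open as Hicks's A-realizability conjecture in codimension `n`):
insert, after `(V : TropicalTorusCycle (2 * n) n P.Q)`, the hypothesis that distinct top cells have
disjoint relative interiors in `B_Q`:
`(hV : ∀ (σ σ' : Fin V.numCells) (z : Fin (2 * n) → ℤ) (b : Fin (2 * n) → ℝ),
   b ∈ intrinsicInterior ℝ (cellHull P.Q V σ) →
   b + P.Q *ᵥ (fun i => (z i : ℝ)) ∈ intrinsicInterior ℝ (cellHull P.Q V σ') → σ = σ' ∧ z = 0)`.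
The witness MISSES C′: presented face-to-face (`b₀` a vertex of both triangulations) the disjoint
union of the two flat Lagrangian 4-tori `T_k × (α_k + L_{T_k}^⊥/ℤ²)`, `k = 1, 2`, is a graded
Lagrangian immersion (one transverse double point over `b₀`), `0`-close to `|V|`, and conormal with
multiplicity one over every core (a vertex never lies in an `ε`-core) — an `IsGeometricLift` for
every `ε > 0`. (Class-level alternative for the planner: quantify `∃ V'` with the same
`WeilFamily.functional δ` BEFORE `∀ ε > 0`; quantifying it after `ε` is trivially true by
subdivision + the empty manifold.)

Refuter seat refuter-rattack-stmt-HodgeConjecture-18677-0, 2026-08-17. No new public definitions: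
the witness data are `private` in the sub-namespace `MirrorBraneLiftLagrangianLiftRefutation`.
-/

noncomputable section

namespace Summit.HodgeConjecture.HodgeConjecture.Theorems

open scoped Manifold Matrix BigOperators
open Literature.AlgebraicGeometry.Tropical Literature.Geometry.Symplectic Literature.Geometry.Manifold

namespace MirrorBraneLiftLagrangianLiftRefutation

/-- `J = √-1` on `ℤ⁴ = ℤ[i]²` is antisymmetric, so `Q = 1` is `J`-adapted. [folklore] -/
private theorem J_skew :
    (WeilFamily.J 2 1 * (1 : Matrix (Fin (2 * 2)) (Fin (2 * 2)) ℝ))ᵀ = -(WeilFamily.J 2 1 * 1) := by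
  rw [Matrix.mul_one]
  ext a b
  simp only [Matrix.transpose_apply, Matrix.neg_apply, WeilFamily.J, Nat.cast_one]
  fin_cases a <;> fin_cases b <;> norm_num

/-- The square Gaussian tropical Weil torus `ℝ⁴/ℤ⁴` (`n = 2`, `δ = 1`, `Q = 1`). [folklore] -/
private def P : WeilFamily.Polarization 2 1 := ⟨1, J_skew, Matrix.PosDef.one⟩

/-- Frame `(e₀ | e₁)`. [folklore] -/
private def frameA : Matrix (Fin (2 * 2)) (Fin 2) ℤ := Matrix.of ![![1, 0], ![0, 1], ![0, 0], ![0, 0]]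

/-- Frame `(e₂ | e₃)`. [folklore] -/
private def frameB : Matrix (Fin (2 * 2)) (Fin 2) ℤ := Matrix.of ![![0, 0], ![0, 0], ![1, 0], ![0, 1]]

/-- Edge coefficients of a "lower" triangle `v₀, v₀ + l₁, v₀ + l₁ + l₂`. [folklore] -/
private def Tlow : Matrix (Fin 2) (Fin 2) ℝ := !![1, 1; 0, 1]

/-- Edge coefficients of an "upper" triangle `v₀, v₀ + l₁ + l₂, v₀ + l₂`. [folklore] -/
private def Tup : Matrix (Fin 2) (Fin 2) ℝ := !![1, 0; 1, 1]

/-- Lower triangle of the subtorus `⟨e₀, e₁⟩`. [folklore] -/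
private def cell0 : TropicalCell (2 * 2) 2 where
  weight := 1
  weight_pos := Nat.one_pos
  vertex := ![![0, 0, 0, 0], ![1, 0, 0, 0], ![1, 1, 0, 0]]
  frame := frameA
  edgeCoeff := Tlow
  vertex_succ_sub := by
    intro j a
    fin_cases j <;> fin_cases a <;> simp [frameA, Tlow, Fin.sum_univ_two]
  edgeCoeff_det_pos := by simp [Tlow, Matrix.det_fin_two]
  frame_saturated := ⟨frameAᵀ, by
    ext i j
    fin_cases i <;> fin_cases j <;> simp [frameA, Matrix.mul_apply, Fin.sum_univ_four]⟩

/-- Upper triangle of the subtorus `⟨e₀, e₁⟩`. [folklore] -/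
private def cell1 : TropicalCell (2 * 2) 2 where
  weight := 1
  weight_pos := Nat.one_pos
  vertex := ![![0, 0, 0, 0], ![1, 1, 0, 0], ![0, 1, 0, 0]]
  frame := frameA
  edgeCoeff := Tup
  vertex_succ_sub := by
    intro j a
    fin_cases j <;> fin_cases a <;> simp [frameA, Tup, Fin.sum_univ_two]
  edgeCoeff_det_pos := by simp [Tup, Matrix.det_fin_two]
  frame_saturated := ⟨frameAᵀ, by
    ext i j
    fin_cases i <;> fin_cases j <;> simp [frameA, Matrix.mul_apply, Fin.sum_univ_four]⟩

/-- Lower triangle of the translated subtorus `q + ⟨e₂, e₃⟩`, `q = (3/5, 3/10, -3/5, -3/10)`. [folklore] -/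
private def cell2 : TropicalCell (2 * 2) 2 where
  weight := 1
  weight_pos := Nat.one_pos
  vertex := ![![3/5, 3/10, -3/5, -3/10], ![3/5, 3/10, 2/5, -3/10], ![3/5, 3/10, 2/5, 7/10]]
  frame := frameB
  edgeCoeff := Tlow
  vertex_succ_sub := by
    intro j a
    fin_cases j <;> fin_cases a <;> simp [frameB, Tlow, Fin.sum_univ_two] <;> norm_num
  edgeCoeff_det_pos := by simp [Tlow, Matrix.det_fin_two]
  frame_saturated := ⟨frameBᵀ, by
    ext i j
    fin_cases i <;> fin_cases j <;> simp [frameB, Matrix.mul_apply, Fin.sum_univ_four]⟩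

/-- Upper triangle of the translated subtorus `q + ⟨e₂, e₃⟩`. [folklore] -/
private def cell3 : TropicalCell (2 * 2) 2 where
  weight := 1
  weight_pos := Nat.one_pos
  vertex := ![![3/5, 3/10, -3/5, -3/10], ![3/5, 3/10, 2/5, 7/10], ![3/5, 3/10, -3/5, 7/10]]
  frame := frameB
  edgeCoeff := Tup
  vertex_succ_sub := by
    intro j a
    fin_cases j <;> fin_cases a <;> simp [frameB, Tup, Fin.sum_univ_two] <;> norm_num
  edgeCoeff_det_pos := by simp [Tup, Matrix.det_fin_two]
  frame_saturated := ⟨frameBᵀ, by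
    ext i j
    fin_cases i <;> fin_cases j <;> simp [frameB, Matrix.mul_apply, Fin.sum_univ_four]⟩

/-- Reference facets: vertical / diagonal / horizontal edge of each of the two subtori. [folklore] -/
private def refFacet : Fin 6 → Fin 2 → Fin (2 * 2) → ℝ :=
  ![![![0, 0, 0, 0], ![0, 1, 0, 0]],
    ![![0, 0, 0, 0], ![1, 1, 0, 0]],
    ![![0, 0, 0, 0], ![1, 0, 0, 0]],
    ![![3/5, 3/10, -3/5, -3/10], ![3/5, 3/10, -3/5, 7/10]],
    ![![3/5, 3/10, -3/5, -3/10], ![3/5, 3/10, 2/5, 7/10]],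
    ![![3/5, 3/10, -3/5, -3/10], ![3/5, 3/10, 2/5, -3/10]]]

/-- Facet classes of the slots `(σ, i)`. [folklore] -/
private def facetClass : Fin 4 → Fin 3 → Fin 6 :=
  ![![0, 1, 2], ![2, 0, 1], ![3, 4, 5], ![5, 3, 4]]

/-- Facet re-orderings: the facet opposite `v₀` of an upper triangle is matched reversed. [folklore] -/
private def facetPerm : Fin 4 → Fin 3 → Equiv.Perm (Fin 2) :=
  ![![1, 1, 1], ![Equiv.swap 0 1, 1, 1], ![1, 1, 1], ![Equiv.swap 0 1, 1, 1]]

/-- Facet lattice shifts. [folklore] -/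
private def facetShift : Fin 4 → Fin 3 → Fin (2 * 2) → ℤ :=
  ![![![1, 0, 0, 0], 0, 0], ![![0, 1, 0, 0], 0, 0], ![![0, 0, 1, 0], 0, 0], ![![0, 0, 0, 1], 0, 0]]

/-- The witness cycle: the transversal flat 2-subtori `⟨e₀,e₁⟩` and `q + ⟨e₂,e₃⟩` of `ℝ⁴/ℤ⁴`, each
triangulated by two triangles, meeting at the single point `b₀ = (3/5, 3/10, 0, 0)` which is interior to
the top cells `cell0` and `cell2`. [folklore] -/
private def V : TropicalTorusCycle (2 * 2) 2 P.Q where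
  numCells := 4
  cell := ![cell0, cell1, cell2, cell3]
  numFacetClasses := 6
  refFacet := refFacet
  facetClass := facetClass
  facetPerm := facetPerm
  facetShift := facetShift
  facet_eq := by
    have hQ : P.Q = 1 := rfl
    intro σ i j a
    rw [hQ]
    simp only [Matrix.one_apply, ite_mul, one_mul, zero_mul, Finset.sum_ite_eq, Finset.mem_univ, if_true]
    fin_cases σ <;> fin_cases i <;> fin_cases j <;> fin_cases a <;>
      simp [cell0, cell1, cell2, cell3, refFacet, facetClass, facetPerm, facetShift, Fin.succAbove,
        Equiv.swap_apply_left, Equiv.swap_apply_right] <;> norm_num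
  balanced := by
    intro f S
    simp only [Fin.sum_univ_succ, Fin.sum_univ_zero]
    fin_cases f <;>
      simp [facetClass, facetPerm, cell0, cell1, cell2, cell3, Equiv.Perm.sign_swap', Fin.succ]


/-- The base coordinate of `pt b y` is `b` modulo the period lattice `Qℤᵍ`. [folklore] -/
private theorem baseRep_pt {g : ℕ} (Q : Matrix (Fin g) (Fin g) ℝ) [Invertible Q] (b y : Fin g → ℝ) :
    ∃ z : Fin g → ℤ, CotangentTorus.baseRep Q (CotangentTorus.pt Q b y) = b + Q *ᵥ fun i => (z i : ℝ) := by
  obtain ⟨n, hn⟩ := (FlatTorus.mk_eq_mk_iff (cotangentFrame Q) (Sum.elim (⅟Q *ᵥ b) y)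
    (FlatTorus.lift (cotangentFrame Q) (CotangentTorus.pt Q b y))).1 (by rw [FlatTorus.mk_lift]; rfl)
  refine ⟨fun i => n (Sum.inl i), ?_⟩
  have h : (fun i => FlatTorus.lift (cotangentFrame Q) (CotangentTorus.pt Q b y) (Sum.inl i)) =
      ⅟Q *ᵥ b + fun i => (n (Sum.inl i) : ℝ) := by
    funext i
    rw [hn]
    rfl
  unfold CotangentTorus.baseRep
  rw [h, Matrix.mulVec_add, Matrix.mulVec_mulVec, mul_invOf_self, Matrix.one_mulVec]

/-- Two presentations `pt b y = pt b' y'` of one point have fibre coordinates congruent modulo `ℤᵍ`.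
[folklore] -/
private theorem pt_eq_pt {g : ℕ} (Q : Matrix (Fin g) (Fin g) ℝ) [Invertible Q] {b b' y y' : Fin g → ℝ}
    (h : CotangentTorus.pt Q b y = CotangentTorus.pt Q b' y') : ∃ n : Fin g → ℤ, ∀ i, y' i = y i + n i := by
  obtain ⟨n, hn⟩ := (FlatTorus.mk_eq_mk_iff (cotangentFrame Q) _ _).1 h
  exact ⟨fun i => n (Sum.inr i), fun i => by simpa using congr_fun hn (Sum.inr i)⟩

/-- The intersection point `b₀ = (3/5, 3/10, 0, 0)` of the two subtori. [folklore] -/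
private def b₀ : Fin (2 * 2) → ℝ := ![3/5, 3/10, 0, 0]

/-- The cell `cell0`. [folklore] -/
private def σ₀ : Fin V.numCells := ⟨0, by decide⟩

/-- The cell `cell2`. [folklore] -/
private def σ₂ : Fin V.numCells := ⟨2, by decide⟩

/-- `b₀` lies in the `1/10`-core of `cell0` (barycentric coordinates `(2/5, 3/10, 3/10)`; the relative
sup-ball of radius `1/10` stays inside the triangle). [folklore] -/
private theorem b0_core0 : b₀ ∈ cellCore P.Q V σ₀ (1/10) := by
  have hv : (V.cell σ₀).vertex = ![![0, 0, 0, 0], ![1, 0, 0, 0], ![1, 1, 0, 0]] := rfl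
  refine ⟨?_, ?_⟩
  · show b₀ ∈ convexHull ℝ (Set.range (V.cell σ₀).vertex)
    rw [hv, convexHull_range_eq_exists_affineCombination]
    refine ⟨Finset.univ, ![2/5, 3/10, 3/10], ?_, ?_, ?_⟩
    · intro i _
      fin_cases i <;> norm_num
    · simp [Fin.sum_univ_succ]
      norm_num
    · rw [Finset.affineCombination_eq_linear_combination _ _ _ (by simp [Fin.sum_univ_succ]; norm_num)]
      funext a
      fin_cases a <;> norm_num [Fin.sum_univ_succ, b₀]
  · intro b' hb' hdist
    show b' ∈ convexHull ℝ (Set.range (V.cell σ₀).vertex)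
    rw [hv] at hb' ⊢
    obtain ⟨w, hw1, hb'eq⟩ := eq_affineCombination_of_mem_affineSpan_of_fintype hb'
    rw [Finset.affineCombination_eq_linear_combination _ _ _ hw1] at hb'eq
    have hsum : w 0 + w 1 + w 2 = 1 := by simpa [Fin.sum_univ_succ, add_assoc] using hw1
    have h0 : b' 0 = w 1 + w 2 := by rw [hb'eq]; simp [Fin.sum_univ_succ]
    have h1 : b' 1 = w 2 := by rw [hb'eq]; simp [Fin.sum_univ_succ]
    have hd0 := (dist_le_pi_dist b' b₀ 0).trans_lt hdist
    have hd1 := (dist_le_pi_dist b' b₀ 1).trans_lt hdist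
    rw [Real.dist_eq, abs_lt] at hd0 hd1
    simp only [b₀, Matrix.cons_val_zero, Matrix.cons_val_one] at hd0 hd1
    rw [convexHull_range_eq_exists_affineCombination]
    refine ⟨Finset.univ, w, ?_, hw1, ?_⟩
    · intro i _
      fin_cases i
      · show 0 ≤ w 0
        linarith
      · show 0 ≤ w 1
        linarith
      · show 0 ≤ w 2
        linarith
    · rw [Finset.affineCombination_eq_linear_combination _ _ _ hw1, hb'eq]

/-- `b₀` lies in the `1/10`-core of `cell2` as well. [folklore] -/
private theorem b0_core2 : b₀ ∈ cellCore P.Q V σ₂ (1/10) := by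
  have hv : (V.cell σ₂).vertex =
      ![![3/5, 3/10, -3/5, -3/10], ![3/5, 3/10, 2/5, -3/10], ![3/5, 3/10, 2/5, 7/10]] := rfl
  refine ⟨?_, ?_⟩
  · show b₀ ∈ convexHull ℝ (Set.range (V.cell σ₂).vertex)
    rw [hv, convexHull_range_eq_exists_affineCombination]
    refine ⟨Finset.univ, ![2/5, 3/10, 3/10], ?_, ?_, ?_⟩
    · intro i _
      fin_cases i <;> norm_num
    · simp [Fin.sum_univ_succ]
      norm_num
    · rw [Finset.affineCombination_eq_linear_combination _ _ _ (by simp [Fin.sum_univ_succ]; norm_num)]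
      funext a
      fin_cases a <;> norm_num [Fin.sum_univ_succ, b₀]
  · intro b' hb' hdist
    show b' ∈ convexHull ℝ (Set.range (V.cell σ₂).vertex)
    rw [hv] at hb' ⊢
    obtain ⟨w, hw1, hb'eq⟩ := eq_affineCombination_of_mem_affineSpan_of_fintype hb'
    rw [Finset.affineCombination_eq_linear_combination _ _ _ hw1] at hb'eq
    have hsum : w 0 + w 1 + w 2 = 1 := by simpa [Fin.sum_univ_succ, add_assoc] using hw1
    have h2 : b' 2 = -3/5 * w 0 + 2/5 * w 1 + 2/5 * w 2 := by
      rw [hb'eq]; simp [Fin.sum_univ_succ]; ring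
    have h3 : b' 3 = -3/10 * w 0 - 3/10 * w 1 + 7/10 * w 2 := by
      rw [hb'eq]; simp [Fin.sum_univ_succ]; ring
    have hd2 := (dist_le_pi_dist b' b₀ 2).trans_lt hdist
    have hd3 := (dist_le_pi_dist b' b₀ 3).trans_lt hdist
    have hb2 : b₀ 2 = 0 := rfl
    have hb3 : b₀ 3 = 0 := rfl
    rw [Real.dist_eq, abs_lt] at hd2 hd3
    rw [hb2] at hd2
    rw [hb3] at hd3
    rw [convexHull_range_eq_exists_affineCombination]
    refine ⟨Finset.univ, w, ?_, hw1, ?_⟩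
    · intro i _
      fin_cases i
      · show 0 ≤ w 0
        linarith
      · show 0 ≤ w 1
        linarith
      · show 0 ≤ w 2
        linarith
    · rw [Finset.affineCombination_eq_linear_combination _ _ _ hw1, hb'eq]

/-- **The obstruction.** No map `f` is conormal over both cores: the fibre of `f(L)` over `b₀` would be
a union of translates of `⟨e₂, e₃⟩/ℤ²` (cell `cell0`) and simultaneously of translates of
`⟨e₀, e₁⟩/ℤ²` (cell `cell2`), forcing `1/2 ∈ ℤ`. [folklore] -/
private theorem key {L : Type} [TopologicalSpace L] [ChartedSpace (EuclideanSpace ℝ (Fin (2 * 2))) L]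
    (f : L → CotangentTorus P.Q) (hf : IsConormalOver P.Q V (1/10) f) : False := by
  obtain ⟨a, -, hA, -⟩ := hf σ₀
  obtain ⟨a', -, hA', -⟩ := hf σ₂
  set j₀ : Fin (V.cell σ₀).weight := ⟨0, (V.cell σ₀).weight_pos⟩ with hj₀
  set j₂ : Fin (V.cell σ₂).weight := ⟨0, (V.cell σ₂).weight_pos⟩ with hj₂
  have step : ∀ c ∈ conormalDir P.Q V σ₀, ∃ n : ℤ, a' j₂ 2 = a j₀ 2 + c 2 + n := by
    intro c hc
    have hR : CotangentTorus.pt P.Q b₀ (a j₀ + c) ∈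
        {t ∈ Set.range f | ∃ z : Fin (2 * 2) → ℤ,
          CotangentTorus.baseRep P.Q t + P.Q *ᵥ (fun i => (z i : ℝ)) ∈ cellCore P.Q V σ₀ (1/10)} :=
      (Set.ext_iff.1 hA _).2 ⟨b₀, b0_core0, j₀, c, hc, rfl⟩
    obtain ⟨hrange, -⟩ := hR
    obtain ⟨z₀, hz₀⟩ := baseRep_pt P.Q b₀ (a j₀ + c)
    have hbase : CotangentTorus.baseRep P.Q (CotangentTorus.pt P.Q b₀ (a j₀ + c)) +
        P.Q *ᵥ (fun i => ((-z₀ i : ℤ) : ℝ)) = b₀ := by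
      have : (fun i => ((-z₀ i : ℤ) : ℝ)) = -fun i => (z₀ i : ℝ) := by
        funext i
        simp
      rw [hz₀, this, Matrix.mulVec_neg, add_neg_cancel_right]
    have hL : CotangentTorus.pt P.Q b₀ (a j₀ + c) ∈
        {t | ∃ b ∈ cellCore P.Q V σ₂ (1/10), ∃ j, ∃ c ∈ conormalDir P.Q V σ₂,
          t = CotangentTorus.pt P.Q b (a' j + c)} :=
      (Set.ext_iff.1 hA' _).1 ⟨hrange, fun i => -z₀ i, by rw [hbase]; exact b0_core2⟩
    obtain ⟨b', -, j', c', hc', heq⟩ := hL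
    obtain ⟨nv, hn⟩ := pt_eq_pt P.Q heq
    have hlt : (j' : ℕ) < 1 := j'.isLt
    have hj' : j' = j₂ := Fin.ext (by rw [hj₂]; show (j' : ℕ) = 0; omega)
    subst hj'
    have hc'2 : c' 2 = 0 := by
      have := hc' 0
      simpa [V, cell2, frameB, Fin.sum_univ_four, σ₂] using this
    have h2 := hn 2
    simp only [Pi.add_apply] at h2
    exact ⟨nv 2, by linarith⟩
  obtain ⟨n₁, h₁⟩ := step 0 (by
    intro j
    simp)
  obtain ⟨n₂, h₂⟩ := step (fun i => if i = 2 then 1/2 else 0) (by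
    intro j
    fin_cases j <;> simp [V, cell0, frameA, σ₀])
  simp only [Pi.zero_apply, add_zero, if_true] at h₁ h₂
  have h3 : ((2 * (n₁ - n₂) : ℤ) : ℝ) = ((1 : ℤ) : ℝ) := by
    push_cast
    linarith
  have h4 : 2 * (n₁ - n₂) = 1 := by exact_mod_cast h3
  omega

end MirrorBraneLiftLagrangianLiftRefutation


set_option linter.dupNamespace false in
/-- Refutes `MirrorBraneLift.LagrangianLift` [refuted-misstated]: the crux quantifies over EVERY term
`V : TropicalTorusCycle (2n) n P.Q`, a presentation format whose cells may overlap (the structure only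
certifies closedness; consumers were meant to be class-level, see its docstring), while
`IsGeometricLift.conormal` pins the fibre of `f(L)` over the `ε`-core of EACH cell to that cell's own
conormal direction. Witness (`n = 2`, `δ = 1`, `Q = 1`, `ε = 1/10`): `V` = the two transversal flat
2-subtori `⟨e₀,e₁⟩/ℤ²` and `(3/5,3/10,-3/5,-3/10) + ⟨e₂,e₃⟩/ℤ²` of `ℝ⁴/ℤ⁴`, two triangles each, whose
intersection point `b₀ = (3/5,3/10,0,0)` is interior to a top cell of each; over `b₀` the fibre of any
lift would be a union of translates of `⟨e₂,e₃⟩` and of `⟨e₀,e₁⟩` at once, so no `L`, `f` exists (not even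
the empty manifold). Repaired statement C′ (believed as open as Hicks's A-realizability; the witness
misses it, since presented face-to-face — `b₀` a vertex of all eight triangles — the disjoint union of
the two flat Lagrangian 4-tori `N^*T₁/N^*_ℤT₁ ⊔ N^*T₂/N^*_ℤT₂` IS a graded immersed geometric lift):
add the hypothesis that the presentation is face-to-face modulo the period lattice,
`(hV : ∀ σ σ' (z : Fin (2*n) → ℤ) (b : Fin (2*n) → ℝ), b ∈ relint (cellHull P.Q V σ) →
  b + P.Q *ᵥ (fun i => (z i : ℝ)) ∈ cellHull P.Q V σ' → σ = σ' ∧ z = 0 ∨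
  (b + P.Q *ᵥ (fun i => (z i : ℝ)) ∈ a proper face of σ'))` — i.o.w. distinct top cells have disjoint
relative interiors in `B_Q` and meet along common faces — before `∀ ε > 0, ∃ L f, IsGeometricLift P.Q V ε f`
(equivalently: restate `IsConormalOver` over the `ε`-core of `|V| ∖ N_ε(Sing |V|)` instead of per cell).
Refuter seat refuter-rattack-stmt-HodgeConjecture-18677-0, 2026-08-17. [folklore] -/
theorem MirrorBraneLiftLagrangianLift_refuted :
    ¬ Summit.HodgeConjecture.HodgeConjecture.Theses.MirrorBraneLift.LagrangianLift := by
  intro h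
  obtain ⟨L, _i₁, _i₂, _i₃, _i₄, _i₅, f, hf⟩ :=
    h 2 le_rfl 1 le_rfl MirrorBraneLiftLagrangianLiftRefutation.P
      MirrorBraneLiftLagrangianLiftRefutation.V (1/10) (by norm_num)
  exact MirrorBraneLiftLagrangianLiftRefutation.key f hf.conormal

end Summit.HodgeConjecture.HodgeConjecture.Theorems
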